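/-
Copyright (c) 2026 the pub-hodgecm-mathlib formalisation cell (harness21).  Dealer ∕ tier-0 assembler seat hodgecm-mathlib-LH4-plan (g10); heir LEAD F0P3a-plan (g18)
T17-36 «dealer starts the tier-1 modules»; F0P3a-p01 (g30) 20:35:46Z (U4_Rows handed back); desk INVENTORY-TIER1 v1.1 §U4.  2026-09-03.
BY-WRITE workfile (`ledger crux write stmt-HodgeConjecture-24833 Lines/F0_P3c_DyRamFourFrame_U4_Rows.lean`); never `skeleton check` (s1809 (3)); no registry act.
-/
import Summits.HodgeConjecture.HodgeConjecture.Theorems.F0P3cDyRamFourFramePieces              -- ★ DEFS №3 (p854653): pieces, `gselStar`, `PiecePropsWild`, `RankTableWild`, `mstarFn`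
import Summits.HodgeConjecture.HodgeConjecture.Theorems.F0P3cDyRamFourFrameUnipotentLabelDefs   -- DEFS №6 (dealer cand 7e8bd62354c50f9c; filed by a prover seat): `NormClassPlus`, `unipotentLabel`
import Summits.HodgeConjecture.HodgeConjecture.Theorems.F0P3cDyRamUnipotentLabelInjOn         -- ★ p854790 (LH4-p02 g12): pays T1 `stub_U4_label_injOn` BY NAME
import Summits.HodgeConjecture.HodgeConjecture.Theorems.F0P3cDyRamPiecePropsUnit0            -- ★ p854783 (F0P3-p01 g30): pays `stub_U4_pieceProps_unit0` BY NAME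
import Summits.HodgeConjecture.HodgeConjecture.Theorems.F0P3cDyRamPiecePropsProfiles          -- ★ p854832 (B-p08 g41): pays `stub_U4_pieceProps_transvPlus/_transvMinus/_reg` BY NAME
import Summits.HodgeConjecture.HodgeConjecture.Theorems.F0P3cDyRamTableVanishing                -- ★ p854888 (LH4-p03 g11): pays T2 `stub_U4_table_vanishing` BY NAME
import Summits.HodgeConjecture.HodgeConjecture.Theorems.F0P3cDyRamTableDiagNeZero               -- ★ p854943 (LH4-p02 g12 + LH4-p13 g0 helpers): pays T3 `stub_U4_table_diag_ne_zero` BY NAME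
import Mathlib.LinearAlgebra.Matrix.Block                                                      -- `Matrix.det_of_lowerTriangular`, `Matrix.BlockTriangular`
import HarnessLib

/-!
# LH4 «(D-RAM) FOUR-FRAME» LINE — TIER-1 MODULE `U4_Rows` — ED. 4 (7 of 7 stubs PAID as theorem lines — UNIT U4 SORRY-FREE: §1 ★ p854783 + ★ p854832, T1 ★ p854790, T2 ★ p854888, T3 ★ p854943; signatures byte-identical to ED. 1 b2ef357bfcbb4be0; exports `piecePropsWild_gselStar`, `rankTableWild_gselStar` sorry-free)

Crux H413 = `stmt-HodgeConjecture-24833`; tier-0 line ★ `Cruxes/H413/Lines/F0_P3c_DyRamFourFrame.lean` (commit d971dfe1e7a6, b2df461498609bc0).  THIS MODULE PAYS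
TWO OF THE SIX TIER-0 STUBS BY NAME through sorry-free per-unit assemblies (LEAD T17-31 (R-9)∕(R-10)): `stub_pieceProps : PiecePropsWild mstarFn gselStar` ⇐
`piecePropsWild_of` (§1, four per-piece stubs) and `stub_rankTableWild : RankTableWild gselStar` ⇐ `rankTableWild_of` (§2, three table stubs + the kernel-checked
lower-triangular determinant §0).  The four ROW stubs `stub_rows_* : PieceRowsWild gselStar j` (iv-b) STAY TIER-0 STUBS (their fold = U3 laws → ★ #11
`anchorRows_of_fourFrameLaws` → U2G∕U2H identities is typed in those units, not restated here — no costume); `mstar_sufficient`∕`fold_byName` of the desk list are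
already the kernel-checked tier-0 composition `DyRamCore_of` (nothing to state).

STUBS (7; `sorry` ONLY inside `stub_U4_*`; every stub binds the place datum `(w, hw, _he, _h2, ϖ, _hϖ)`; no free constant; no shared `∃`-witness — the labelling is
the explicit ★-to-be `unipotentLabel` of DEFS №6):
* §1 (iv-0) `stub_U4_pieceProps_unit0 ∕ _transvPlus ∕ _transvMinus ∕ _reg : PiecePropsWild mstarFn (fun _ : Fin 1 => piece)` — smooth, `tsupport ⊆ K`, `Ad K`-invariant,
  left-`K(ϖ^{m*})`-invariant, ONE PIECE EACH (S ∕ M ∕ M ∕ S–M: `1_K` is routine; for `f_{T±}` the left-invariance at `m* = ℓ₀ + 2d − 1` is REF5 R5-2 (c)∕R5-3 (B)(C)'s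
  window computation and the `Ad K`-invariance of `LabelPlus` is F0P3a-p01 (B3); for `f_reg` the condition `X² ∉ ϖ^{m*}M₃(𝒪)` is `K`-bi-stable at level `m*`).
* §2 (iv-a) `stub_U4_label_injOn` (M–L: CLASSIFICATION — `unipotentLabel` is injective on unipotent classes: `X = 0` only at `1`; two transvection classes `a∕c ∈ F^×∕N(E^×)`
  by Witt transitivity on isotropic lines + the Levi `E^×` rescaling `a ↦ a·N(λ)`; ONE regular unipotent class — `H¹(F, Z(U₃)) → H¹(F, U₃)` is injective in ODD rank
  (`disc(a·h) = a³·disc h ≡ a`), so `ker = 1`; KILL-SWITCH: a second regular class at some wild place kills this stub and asks for a fifth piece);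
  `stub_U4_table_vanishing` (S–M: SUPPORT — entries strictly above the diagonal vanish identically on the orbit: `f_{T±}(1) = f_reg(1) = 0` (`X = 0` fails
  `¬InLevel (ℓ₀+1)` resp. `¬InLevel m* (X²)`), `f_reg ≡ 0` on transvections (`X² = 0`), and `f_{T−} ≡ 0` on the class-`+` transvection orbit ∩ `K` ∩ shell because ON THE
  SHELL `LabelPlus ⟺ NormClassPlus` (REF1 (g19) m25 (i): precision `m* − ℓ₀ = 2d − 1` = conductor) — the one M-sized step);
  `stub_U4_table_diag_ne_zero` (M: POSITIVITY — `O_1(1_K) = mass ≠ 0`; `O_{T±}(f_{T±}) > 0` since a depth-`ℓ₀` shell transvection of either class lies in `K` (REF5 R5-3 (B),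
  `ℓ₀ ≡ d (2)`; skew `c` with `v_E(c) = ℓ₀`) and the admissible orbital measure charges the open set it meets; `O_reg(f_reg) > 0` via the standard regular unipotent of `K`,
  whose `X²` has a unit entry).
ASSEMBLIES (sorry-free, axioms TRIO expected): `piecePropsWild_of` (`fin_cases` on `gselStar = ![…]`) and `rankTableWild_of` (labelling `e := unipotentLabel ∘ (↑)`,
injective on `↥S` by `stub_U4_label_injOn` + `_hS`; `det ≠ 0` by §0 `det_ne_zero_of_label`: pull the linear order of `Fin 4` back along the injective `e`, the table is
`BlockTriangular toDual`, ★ `Matrix.det_of_lowerTriangular` gives `det = ∏ diagonal`, non-zero factor-wise) conclude the two tier-0 stub STATEMENTS token for token.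
HONEST LABEL: HC_CM is proved only modulo the 7 printed citations (2 remaining: hLiu418 = stmt-HodgeConjecture-24832, h413 = stmt-HodgeConjecture-24833) until rung 0
closes; this module moves no verdict and no registry (BY-WRITE line file); count-neutral (desk (P-1) «+0»).
-/

noncomputable section

namespace Summit.HodgeConjecture.HodgeConjecture.Cruxes.H413.F0P3cDyRamFourFrameU4

open MeasureTheory Measure NumberField IsDedekindDomain Topology Filter
open Literature.NumberTheory.Automorphic Literature.NumberTheory.Automorphic.UnitaryGroup Literature.NumberTheory.Automorphic.IntegralReduction
open Literature.NumberTheory.Rogawski1990 Literature.NumberTheory.GaloisRepresentations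
open Literature.NumberTheory.Automorphic.HermitianLattice Literature.NumberTheory.Automorphic.UnitaryThreeFourFrame
open Literature.MeasureTheory.Group (descConj)
open Summit.HodgeConjecture.HodgeConjecture.Cruxes.H413.F0P3cDyRamFourFramePieces
open Summit.HodgeConjecture.HodgeConjecture.Cruxes.H413.F0P3cDyRamFourFrameUnipotentLabelDefs
open scoped Matrix MatrixGroups Classical ValuativeRel WithZero

/-! ## §0  the determinant of a labelled lower-triangular table (pure linear algebra, sorry-free) -/

/-- A square table `(T i (κ i'))_{i,i'}` whose columns are selected by an INJECTIVE label `κ : ι → Fin n`, which vanishes strictly above the label diagonal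
(`κ i < j ⇒ T i j = 0`) and is non-zero on it (`T i (κ i) ≠ 0`), has non-zero determinant: order `ι` by `κ`, the matrix is lower triangular, `det = ∏ diagonal`. -/
theorem det_ne_zero_of_label {ι : Type*} [Fintype ι] [DecidableEq ι] {n : ℕ} (T : ι → Fin n → ℂ) (κ : ι → Fin n)
    (hκ : Function.Injective κ) (hvan : ∀ i j, κ i < j → T i j = 0) (hdiag : ∀ i, T i (κ i) ≠ 0) :
    (Matrix.of fun i i' => T i (κ i')).det ≠ 0 := by
  letI : LinearOrder ι := LinearOrder.lift' κ hκ
  have hBT : (Matrix.of fun i i' => T i (κ i')).BlockTriangular OrderDual.toDual := by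
    intro i j hij
    have hij' : κ i < κ j := OrderDual.toDual_lt_toDual.1 hij
    simpa only [Matrix.of_apply] using hvan i (κ j) hij'
  rw [Matrix.det_of_lowerTriangular _ hBT]
  exact Finset.prod_ne_zero_iff.2 fun i _ => by simpa only [Matrix.of_apply] using hdiag i

/-! ## §1  unit (iv-0): the piece properties, one stub per piece, and the assembly paying tier-0 `stub_pieceProps` BY NAME -/

/-- (iv-0)·0 · PAID (★ p854783, F0P3-p01 (g30)) · `1_K` is smooth, `K`-supported, `Ad K`-invariant, left-`K(ϖ^{m*})`-invariant (S: `K(ϖ^M) ⊆ K` for every `M`, incl. the junk `M = 0`). -/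
theorem stub_U4_pieceProps_unit0 : PiecePropsWild mstarFn (fun _ : Fin 1 => pieceUnit0) :=
  Summit.HodgeConjecture.HodgeConjecture.Cruxes.H413.F0P3cDyRamPiecePropsUnit0.piecePropsWild_unit0  -- PAID ★ p854783

/-- (iv-0)·1 · PAID (★ p854832, B-p08 (g41)) · `f_{T+}` (M: level-`m*` left-invariance of the shell-and-label set, REF5 R5-2 (c)∕R5-3 (B)(C); `Ad K`-invariance of `valueSetMod`, F0P3a-p01 (B3)). -/
theorem stub_U4_pieceProps_transvPlus : PiecePropsWild mstarFn (fun _ : Fin 1 => pieceTransvPlus) :=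
  Summit.HodgeConjecture.HodgeConjecture.Cruxes.H413.F0P3cDyRamPiecePropsProfiles.piecePropsWild_transvPlus  -- PAID ★ p854832

/-- (iv-0)·2 · PAID (★ p854832) · `f_{T−}` (M: as `f_{T+}` with the label negated — same shell, complementary label). -/
theorem stub_U4_pieceProps_transvMinus : PiecePropsWild mstarFn (fun _ : Fin 1 => pieceTransvMinus) :=
  Summit.HodgeConjecture.HodgeConjecture.Cruxes.H413.F0P3cDyRamPiecePropsProfiles.piecePropsWild_transvMinus  -- PAID ★ p854832

/-- (iv-0)·3 · PAID (★ p854832) · `f_reg` (S–M: `X² ∉ ϖ^{m*}M₃(𝒪)` is stable under `u ↦ k·u`, `k ∈ K(ϖ^{m*})`, and under `Ad K`; locally constant on `K`). -/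
theorem stub_U4_pieceProps_reg : PiecePropsWild mstarFn (fun _ : Fin 1 => pieceReg) :=
  Summit.HodgeConjecture.HodgeConjecture.Cruxes.H413.F0P3cDyRamPiecePropsProfiles.piecePropsWild_reg  -- PAID ★ p854832

/-- ASSEMBLY (iv-0): the four per-piece property stubs give tier-0 `stub_pieceProps : PiecePropsWild mstarFn gselStar` TOKEN FOR TOKEN (`gselStar = ![1_K, f_{T+}, f_{T−}, f_reg]`). -/
theorem piecePropsWild_of
    (h0 : PiecePropsWild mstarFn (fun _ : Fin 1 => pieceUnit0)) (h1 : PiecePropsWild mstarFn (fun _ : Fin 1 => pieceTransvPlus))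
    (h2 : PiecePropsWild mstarFn (fun _ : Fin 1 => pieceTransvMinus)) (h3 : PiecePropsWild mstarFn (fun _ : Fin 1 => pieceReg)) :
    PiecePropsWild mstarFn gselStar := by
  intro L _ _ _ v w hw he h2' ϖ hϖ _ _ _ _ j
  fin_cases j
  · exact h0 L w hw he h2' ϖ hϖ 0
  · exact h1 L w hw he h2' ϖ hϖ 0
  · exact h2 L w hw he h2' ϖ hϖ 0
  · exact h3 L w hw he h2' ϖ hϖ 0


/-- EXPORT (iv-0) CLOSED: with the four §1 rows PAID (★ p854783, ★ p854832) the tier-0 statement `stub_pieceProps : PiecePropsWild mstarFn gselStar` holds sorry-free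
(tier 0 pays it BY NAME from the ★ `Theorems/` twin of this line, not by importing this workfile). -/
theorem piecePropsWild_gselStar : PiecePropsWild mstarFn gselStar :=
  piecePropsWild_of stub_U4_pieceProps_unit0 stub_U4_pieceProps_transvPlus stub_U4_pieceProps_transvMinus stub_U4_pieceProps_reg

/-! ## §2  unit (iv-a): the RANK′-WILD TABLE — classification, support, positivity, and the assembly paying tier-0 `stub_rankTableWild` BY NAME -/

/-- (iv-a)·T1 · PAID (★ p854790, LH4-p02 (g12)) · CLASSIFICATION: the explicit label ★ `unipotentLabel` (DEFS №6) is INJECTIVE on unipotent conjugacy classes of `U(Φ₃)(L⁺_v)` at every wild ramified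
`σ`-stable place (classes `{1, T₊, T₋, reg}`; two transvection classes `↔ F^×∕N(E^×)`, ONE regular class by odd-rank `H¹`-injectivity).  KILL-SWITCH of the symmetric
family: false ⇒ a fifth piece. -/
theorem stub_U4_label_injOn :
    ∀ (L : Type) [Field L] [NumberField L] [IsCMField L]
      {v : HeightOneSpectrum (𝓞 ↥(maximalRealSubfield L))} (w : UnitaryGroup.PlacesOver L v)
      (hw : IsCMField.complexConj L • w.1 = w.1) (_he : v.asIdeal.ramificationIdx' w.1.asIdeal ≠ 1)
      (_h2 : ¬ IsUnit (2 : 𝒪[w.1.adicCompletion L]))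
      (ϖ : (w.1.adicCompletion L)) (_hϖ : Valued.v ϖ = WithZero.exp (-1 : ℤ))
      (c c' : ConjClasses ((UnitaryGroup.cmDatum L 3 (Matrix.of fun i j : Fin 3 => if i.val + j.val + 1 = 3 then (1 : L) else 0)).Local v)),
      (((Quotient.out c : ((UnitaryGroup.cmDatum L 3 (Matrix.of fun i j : Fin 3 => if i.val + j.val + 1 = 3 then (1 : L) else 0)).Local v)).val : GL (Fin 3) (UnitaryGroup.LocalRing L v)).val - 1) ^ 3 = 0 →
      (((Quotient.out c' : ((UnitaryGroup.cmDatum L 3 (Matrix.of fun i j : Fin 3 => if i.val + j.val + 1 = 3 then (1 : L) else 0)).Local v)).val : GL (Fin 3) (UnitaryGroup.LocalRing L v)).val - 1) ^ 3 = 0 →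
      unipotentLabel L w hw ϖ c = unipotentLabel L w hw ϖ c' → c = c' :=
  Summit.HodgeConjecture.HodgeConjecture.Cruxes.H413.F0P3cDyRamUnipotentLabelInjOn.unipotentLabel_injOn_of_placesOver  -- PAID ★ p854790

/-- (iv-a)·T2 · SUPPORT: the orbital-integral table `O_u(gselStar j)` VANISHES strictly above the label diagonal (`unipotentLabel u < j`): the shell pieces and `f_reg`
vanish at `1`, `f_reg` vanishes on transvections, `f_{T−}` vanishes on the class-`+` transvection orbit (on the shell `LabelPlus ⟺ NormClassPlus`, REF1 m25 (i)). -/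
theorem stub_U4_table_vanishing :
    ∀ (L : Type) [Field L] [NumberField L] [IsCMField L]
      {v : HeightOneSpectrum (𝓞 ↥(maximalRealSubfield L))} (w : UnitaryGroup.PlacesOver L v)
      (hw : IsCMField.complexConj L • w.1 = w.1) (_he : v.asIdeal.ramificationIdx' w.1.asIdeal ≠ 1)
      (_h2 : ¬ IsUnit (2 : 𝒪[w.1.adicCompletion L]))
      (ϖ : (w.1.adicCompletion L)) (_hϖ : Valued.v ϖ = WithZero.exp (-1 : ℤ))
      [MeasurableSpace ((UnitaryGroup.cmDatum L 3 (Matrix.of fun i j : Fin 3 => if i.val + j.val + 1 = 3 then (1 : L) else 0)).Local v)] [BorelSpace ((UnitaryGroup.cmDatum L 3 (Matrix.of fun i j : Fin 3 => if i.val + j.val + 1 = 3 then (1 : L) else 0)).Local v)]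
      [∀ γ : ((UnitaryGroup.cmDatum L 3 (Matrix.of fun i j : Fin 3 => if i.val + j.val + 1 = 3 then (1 : L) else 0)).Local v), MeasurableSpace (((UnitaryGroup.cmDatum L 3 (Matrix.of fun i j : Fin 3 => if i.val + j.val + 1 = 3 then (1 : L) else 0)).Local v) ⧸ Subgroup.centralizer ({γ} : Set ((UnitaryGroup.cmDatum L 3 (Matrix.of fun i j : Fin 3 => if i.val + j.val + 1 = 3 then (1 : L) else 0)).Local v)))]
      [∀ γ : ((UnitaryGroup.cmDatum L 3 (Matrix.of fun i j : Fin 3 => if i.val + j.val + 1 = 3 then (1 : L) else 0)).Local v), BorelSpace (((UnitaryGroup.cmDatum L 3 (Matrix.of fun i j : Fin 3 => if i.val + j.val + 1 = 3 then (1 : L) else 0)).Local v) ⧸ Subgroup.centralizer ({γ} : Set ((UnitaryGroup.cmDatum L 3 (Matrix.of fun i j : Fin 3 => if i.val + j.val + 1 = 3 then (1 : L) else 0)).Local v)))]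
      (S : Finset (ConjClasses ((UnitaryGroup.cmDatum L 3 (Matrix.of fun i j : Fin 3 => if i.val + j.val + 1 = 3 then (1 : L) else 0)).Local v)))
      (_hS : ∀ u ∈ S, (((Quotient.out u : ((UnitaryGroup.cmDatum L 3 (Matrix.of fun i j : Fin 3 => if i.val + j.val + 1 = 3 then (1 : L) else 0)).Local v)).val : GL (Fin 3) (UnitaryGroup.LocalRing L v)).val - 1) ^ 3 = 0)
      (mU : OrbitalMeasureFamily ((UnitaryGroup.cmDatum L 3 (Matrix.of fun i j : Fin 3 => if i.val + j.val + 1 = 3 then (1 : L) else 0)).Local v)) (_hmU : mU.IsAdmissibleOn (fun γ => (ConjClasses.mk γ) ∈ S))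
      (_hRao : ∀ u ∈ S, ∀ f : ((UnitaryGroup.cmDatum L 3 (Matrix.of fun i j : Fin 3 => if i.val + j.val + 1 = 3 then (1 : L) else 0)).Local v) → ℂ, IsLocSmooth f →
        Integrable (descConj (Quotient.out u : ((UnitaryGroup.cmDatum L 3 (Matrix.of fun i j : Fin 3 => if i.val + j.val + 1 = 3 then (1 : L) else 0)).Local v))
          (Subgroup.centralizer ({(Quotient.out u : ((UnitaryGroup.cmDatum L 3 (Matrix.of fun i j : Fin 3 => if i.val + j.val + 1 = 3 then (1 : L) else 0)).Local v))} : Set ((UnitaryGroup.cmDatum L 3 (Matrix.of fun i j : Fin 3 => if i.val + j.val + 1 = 3 then (1 : L) else 0)).Local v)))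
          (fun _ hg => Subgroup.mem_centralizer_singleton_iff.1 hg) f) (mU u)),
      ∀ u : ↥S, ∀ j : Fin 4, unipotentLabel L w hw ϖ (u : ConjClasses ((UnitaryGroup.cmDatum L 3 (Matrix.of fun i j : Fin 3 => if i.val + j.val + 1 = 3 then (1 : L) else 0)).Local v)) < j →
        classOrbitalIntegral mU ((gselStar j) L v w hw ϖ) u = 0 :=
  Summit.HodgeConjecture.HodgeConjecture.Cruxes.H413.F0P3cDyRamTableVanishing.table_vanishing  -- PAID ★ p854888

/-- (iv-a)·T3 · POSITIVITY: the label-diagonal entries `O_u(gselStar (unipotentLabel u))` are NON-ZERO for every admissible unipotent datum (`O_1(1_K)` = mass; a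
depth-`ℓ₀` shell transvection of either class and a regular unipotent with `X² ∉ ϖ^{m*}M₃(𝒪)` lie in `K`, REF5 R5-3 (B); admissible orbital measures charge the open
sets they meet). -/
theorem stub_U4_table_diag_ne_zero :
    ∀ (L : Type) [Field L] [NumberField L] [IsCMField L]
      {v : HeightOneSpectrum (𝓞 ↥(maximalRealSubfield L))} (w : UnitaryGroup.PlacesOver L v)
      (hw : IsCMField.complexConj L • w.1 = w.1) (_he : v.asIdeal.ramificationIdx' w.1.asIdeal ≠ 1)
      (_h2 : ¬ IsUnit (2 : 𝒪[w.1.adicCompletion L]))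
      (ϖ : (w.1.adicCompletion L)) (_hϖ : Valued.v ϖ = WithZero.exp (-1 : ℤ))
      [MeasurableSpace ((UnitaryGroup.cmDatum L 3 (Matrix.of fun i j : Fin 3 => if i.val + j.val + 1 = 3 then (1 : L) else 0)).Local v)] [BorelSpace ((UnitaryGroup.cmDatum L 3 (Matrix.of fun i j : Fin 3 => if i.val + j.val + 1 = 3 then (1 : L) else 0)).Local v)]
      [∀ γ : ((UnitaryGroup.cmDatum L 3 (Matrix.of fun i j : Fin 3 => if i.val + j.val + 1 = 3 then (1 : L) else 0)).Local v), MeasurableSpace (((UnitaryGroup.cmDatum L 3 (Matrix.of fun i j : Fin 3 => if i.val + j.val + 1 = 3 then (1 : L) else 0)).Local v) ⧸ Subgroup.centralizer ({γ} : Set ((UnitaryGroup.cmDatum L 3 (Matrix.of fun i j : Fin 3 => if i.val + j.val + 1 = 3 then (1 : L) else 0)).Local v)))]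
      [∀ γ : ((UnitaryGroup.cmDatum L 3 (Matrix.of fun i j : Fin 3 => if i.val + j.val + 1 = 3 then (1 : L) else 0)).Local v), BorelSpace (((UnitaryGroup.cmDatum L 3 (Matrix.of fun i j : Fin 3 => if i.val + j.val + 1 = 3 then (1 : L) else 0)).Local v) ⧸ Subgroup.centralizer ({γ} : Set ((UnitaryGroup.cmDatum L 3 (Matrix.of fun i j : Fin 3 => if i.val + j.val + 1 = 3 then (1 : L) else 0)).Local v)))]
      (S : Finset (ConjClasses ((UnitaryGroup.cmDatum L 3 (Matrix.of fun i j : Fin 3 => if i.val + j.val + 1 = 3 then (1 : L) else 0)).Local v)))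
      (_hS : ∀ u ∈ S, (((Quotient.out u : ((UnitaryGroup.cmDatum L 3 (Matrix.of fun i j : Fin 3 => if i.val + j.val + 1 = 3 then (1 : L) else 0)).Local v)).val : GL (Fin 3) (UnitaryGroup.LocalRing L v)).val - 1) ^ 3 = 0)
      (mU : OrbitalMeasureFamily ((UnitaryGroup.cmDatum L 3 (Matrix.of fun i j : Fin 3 => if i.val + j.val + 1 = 3 then (1 : L) else 0)).Local v)) (_hmU : mU.IsAdmissibleOn (fun γ => (ConjClasses.mk γ) ∈ S))
      (_hRao : ∀ u ∈ S, ∀ f : ((UnitaryGroup.cmDatum L 3 (Matrix.of fun i j : Fin 3 => if i.val + j.val + 1 = 3 then (1 : L) else 0)).Local v) → ℂ, IsLocSmooth f →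
        Integrable (descConj (Quotient.out u : ((UnitaryGroup.cmDatum L 3 (Matrix.of fun i j : Fin 3 => if i.val + j.val + 1 = 3 then (1 : L) else 0)).Local v))
          (Subgroup.centralizer ({(Quotient.out u : ((UnitaryGroup.cmDatum L 3 (Matrix.of fun i j : Fin 3 => if i.val + j.val + 1 = 3 then (1 : L) else 0)).Local v))} : Set ((UnitaryGroup.cmDatum L 3 (Matrix.of fun i j : Fin 3 => if i.val + j.val + 1 = 3 then (1 : L) else 0)).Local v)))
          (fun _ hg => Subgroup.mem_centralizer_singleton_iff.1 hg) f) (mU u)),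
      ∀ u : ↥S, classOrbitalIntegral mU ((gselStar (unipotentLabel L w hw ϖ (u : ConjClasses ((UnitaryGroup.cmDatum L 3 (Matrix.of fun i j : Fin 3 => if i.val + j.val + 1 = 3 then (1 : L) else 0)).Local v)))) L v w hw ϖ) u ≠ 0 :=
  Summit.HodgeConjecture.HodgeConjecture.Cruxes.H413.F0P3cDyRamTableDiagNeZero.table_diag_ne_zero  -- PAID ★ p854943

/-- ASSEMBLY (iv-a): classification + support + positivity give tier-0 `stub_rankTableWild : RankTableWild gselStar` TOKEN FOR TOKEN — labelling
`e := unipotentLabel ∘ (↑)` on `↥S`, injective by T1 and `_hS`, determinant by §0. -/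
theorem rankTableWild_of
    (hInj :
    ∀ (L : Type) [Field L] [NumberField L] [IsCMField L]
      {v : HeightOneSpectrum (𝓞 ↥(maximalRealSubfield L))} (w : UnitaryGroup.PlacesOver L v)
      (hw : IsCMField.complexConj L • w.1 = w.1) (_he : v.asIdeal.ramificationIdx' w.1.asIdeal ≠ 1)
      (_h2 : ¬ IsUnit (2 : 𝒪[w.1.adicCompletion L]))
      (ϖ : (w.1.adicCompletion L)) (_hϖ : Valued.v ϖ = WithZero.exp (-1 : ℤ))
      (c c' : ConjClasses ((UnitaryGroup.cmDatum L 3 (Matrix.of fun i j : Fin 3 => if i.val + j.val + 1 = 3 then (1 : L) else 0)).Local v)),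
      (((Quotient.out c : ((UnitaryGroup.cmDatum L 3 (Matrix.of fun i j : Fin 3 => if i.val + j.val + 1 = 3 then (1 : L) else 0)).Local v)).val : GL (Fin 3) (UnitaryGroup.LocalRing L v)).val - 1) ^ 3 = 0 →
      (((Quotient.out c' : ((UnitaryGroup.cmDatum L 3 (Matrix.of fun i j : Fin 3 => if i.val + j.val + 1 = 3 then (1 : L) else 0)).Local v)).val : GL (Fin 3) (UnitaryGroup.LocalRing L v)).val - 1) ^ 3 = 0 →
      unipotentLabel L w hw ϖ c = unipotentLabel L w hw ϖ c' → c = c')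
    (hVan :
    ∀ (L : Type) [Field L] [NumberField L] [IsCMField L]
      {v : HeightOneSpectrum (𝓞 ↥(maximalRealSubfield L))} (w : UnitaryGroup.PlacesOver L v)
      (hw : IsCMField.complexConj L • w.1 = w.1) (_he : v.asIdeal.ramificationIdx' w.1.asIdeal ≠ 1)
      (_h2 : ¬ IsUnit (2 : 𝒪[w.1.adicCompletion L]))
      (ϖ : (w.1.adicCompletion L)) (_hϖ : Valued.v ϖ = WithZero.exp (-1 : ℤ))
      [MeasurableSpace ((UnitaryGroup.cmDatum L 3 (Matrix.of fun i j : Fin 3 => if i.val + j.val + 1 = 3 then (1 : L) else 0)).Local v)] [BorelSpace ((UnitaryGroup.cmDatum L 3 (Matrix.of fun i j : Fin 3 => if i.val + j.val + 1 = 3 then (1 : L) else 0)).Local v)]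
      [∀ γ : ((UnitaryGroup.cmDatum L 3 (Matrix.of fun i j : Fin 3 => if i.val + j.val + 1 = 3 then (1 : L) else 0)).Local v), MeasurableSpace (((UnitaryGroup.cmDatum L 3 (Matrix.of fun i j : Fin 3 => if i.val + j.val + 1 = 3 then (1 : L) else 0)).Local v) ⧸ Subgroup.centralizer ({γ} : Set ((UnitaryGroup.cmDatum L 3 (Matrix.of fun i j : Fin 3 => if i.val + j.val + 1 = 3 then (1 : L) else 0)).Local v)))]
      [∀ γ : ((UnitaryGroup.cmDatum L 3 (Matrix.of fun i j : Fin 3 => if i.val + j.val + 1 = 3 then (1 : L) else 0)).Local v), BorelSpace (((UnitaryGroup.cmDatum L 3 (Matrix.of fun i j : Fin 3 => if i.val + j.val + 1 = 3 then (1 : L) else 0)).Local v) ⧸ Subgroup.centralizer ({γ} : Set ((UnitaryGroup.cmDatum L 3 (Matrix.of fun i j : Fin 3 => if i.val + j.val + 1 = 3 then (1 : L) else 0)).Local v)))]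
      (S : Finset (ConjClasses ((UnitaryGroup.cmDatum L 3 (Matrix.of fun i j : Fin 3 => if i.val + j.val + 1 = 3 then (1 : L) else 0)).Local v)))
      (_hS : ∀ u ∈ S, (((Quotient.out u : ((UnitaryGroup.cmDatum L 3 (Matrix.of fun i j : Fin 3 => if i.val + j.val + 1 = 3 then (1 : L) else 0)).Local v)).val : GL (Fin 3) (UnitaryGroup.LocalRing L v)).val - 1) ^ 3 = 0)
      (mU : OrbitalMeasureFamily ((UnitaryGroup.cmDatum L 3 (Matrix.of fun i j : Fin 3 => if i.val + j.val + 1 = 3 then (1 : L) else 0)).Local v)) (_hmU : mU.IsAdmissibleOn (fun γ => (ConjClasses.mk γ) ∈ S))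
      (_hRao : ∀ u ∈ S, ∀ f : ((UnitaryGroup.cmDatum L 3 (Matrix.of fun i j : Fin 3 => if i.val + j.val + 1 = 3 then (1 : L) else 0)).Local v) → ℂ, IsLocSmooth f →
        Integrable (descConj (Quotient.out u : ((UnitaryGroup.cmDatum L 3 (Matrix.of fun i j : Fin 3 => if i.val + j.val + 1 = 3 then (1 : L) else 0)).Local v))
          (Subgroup.centralizer ({(Quotient.out u : ((UnitaryGroup.cmDatum L 3 (Matrix.of fun i j : Fin 3 => if i.val + j.val + 1 = 3 then (1 : L) else 0)).Local v))} : Set ((UnitaryGroup.cmDatum L 3 (Matrix.of fun i j : Fin 3 => if i.val + j.val + 1 = 3 then (1 : L) else 0)).Local v)))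
          (fun _ hg => Subgroup.mem_centralizer_singleton_iff.1 hg) f) (mU u)),
      ∀ u : ↥S, ∀ j : Fin 4, unipotentLabel L w hw ϖ (u : ConjClasses ((UnitaryGroup.cmDatum L 3 (Matrix.of fun i j : Fin 3 => if i.val + j.val + 1 = 3 then (1 : L) else 0)).Local v)) < j →
        classOrbitalIntegral mU ((gselStar j) L v w hw ϖ) u = 0)
    (hDiag :
    ∀ (L : Type) [Field L] [NumberField L] [IsCMField L]
      {v : HeightOneSpectrum (𝓞 ↥(maximalRealSubfield L))} (w : UnitaryGroup.PlacesOver L v)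
      (hw : IsCMField.complexConj L • w.1 = w.1) (_he : v.asIdeal.ramificationIdx' w.1.asIdeal ≠ 1)
      (_h2 : ¬ IsUnit (2 : 𝒪[w.1.adicCompletion L]))
      (ϖ : (w.1.adicCompletion L)) (_hϖ : Valued.v ϖ = WithZero.exp (-1 : ℤ))
      [MeasurableSpace ((UnitaryGroup.cmDatum L 3 (Matrix.of fun i j : Fin 3 => if i.val + j.val + 1 = 3 then (1 : L) else 0)).Local v)] [BorelSpace ((UnitaryGroup.cmDatum L 3 (Matrix.of fun i j : Fin 3 => if i.val + j.val + 1 = 3 then (1 : L) else 0)).Local v)]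
      [∀ γ : ((UnitaryGroup.cmDatum L 3 (Matrix.of fun i j : Fin 3 => if i.val + j.val + 1 = 3 then (1 : L) else 0)).Local v), MeasurableSpace (((UnitaryGroup.cmDatum L 3 (Matrix.of fun i j : Fin 3 => if i.val + j.val + 1 = 3 then (1 : L) else 0)).Local v) ⧸ Subgroup.centralizer ({γ} : Set ((UnitaryGroup.cmDatum L 3 (Matrix.of fun i j : Fin 3 => if i.val + j.val + 1 = 3 then (1 : L) else 0)).Local v)))]
      [∀ γ : ((UnitaryGroup.cmDatum L 3 (Matrix.of fun i j : Fin 3 => if i.val + j.val + 1 = 3 then (1 : L) else 0)).Local v), BorelSpace (((UnitaryGroup.cmDatum L 3 (Matrix.of fun i j : Fin 3 => if i.val + j.val + 1 = 3 then (1 : L) else 0)).Local v) ⧸ Subgroup.centralizer ({γ} : Set ((UnitaryGroup.cmDatum L 3 (Matrix.of fun i j : Fin 3 => if i.val + j.val + 1 = 3 then (1 : L) else 0)).Local v)))]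
      (S : Finset (ConjClasses ((UnitaryGroup.cmDatum L 3 (Matrix.of fun i j : Fin 3 => if i.val + j.val + 1 = 3 then (1 : L) else 0)).Local v)))
      (_hS : ∀ u ∈ S, (((Quotient.out u : ((UnitaryGroup.cmDatum L 3 (Matrix.of fun i j : Fin 3 => if i.val + j.val + 1 = 3 then (1 : L) else 0)).Local v)).val : GL (Fin 3) (UnitaryGroup.LocalRing L v)).val - 1) ^ 3 = 0)
      (mU : OrbitalMeasureFamily ((UnitaryGroup.cmDatum L 3 (Matrix.of fun i j : Fin 3 => if i.val + j.val + 1 = 3 then (1 : L) else 0)).Local v)) (_hmU : mU.IsAdmissibleOn (fun γ => (ConjClasses.mk γ) ∈ S))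
      (_hRao : ∀ u ∈ S, ∀ f : ((UnitaryGroup.cmDatum L 3 (Matrix.of fun i j : Fin 3 => if i.val + j.val + 1 = 3 then (1 : L) else 0)).Local v) → ℂ, IsLocSmooth f →
        Integrable (descConj (Quotient.out u : ((UnitaryGroup.cmDatum L 3 (Matrix.of fun i j : Fin 3 => if i.val + j.val + 1 = 3 then (1 : L) else 0)).Local v))
          (Subgroup.centralizer ({(Quotient.out u : ((UnitaryGroup.cmDatum L 3 (Matrix.of fun i j : Fin 3 => if i.val + j.val + 1 = 3 then (1 : L) else 0)).Local v))} : Set ((UnitaryGroup.cmDatum L 3 (Matrix.of fun i j : Fin 3 => if i.val + j.val + 1 = 3 then (1 : L) else 0)).Local v)))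
          (fun _ hg => Subgroup.mem_centralizer_singleton_iff.1 hg) f) (mU u)),
      ∀ u : ↥S, classOrbitalIntegral mU ((gselStar (unipotentLabel L w hw ϖ (u : ConjClasses ((UnitaryGroup.cmDatum L 3 (Matrix.of fun i j : Fin 3 => if i.val + j.val + 1 = 3 then (1 : L) else 0)).Local v)))) L v w hw ϖ) u ≠ 0) :
    RankTableWild gselStar := by
  intro L _ _ _ v w hw he h2 ϖ hϖ _ _ _ _ S hS mU hmU hRao
  have hinj : Function.Injective (fun u : ↥S => unipotentLabel L w hw ϖ (u : ConjClasses ((UnitaryGroup.cmDatum L 3 (Matrix.of fun i j : Fin 3 => if i.val + j.val + 1 = 3 then (1 : L) else 0)).Local v))) := by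
    intro u u' h
    exact Subtype.ext (hInj L w hw he h2 ϖ hϖ u u' (hS u u.2) (hS u' u'.2) h)
  refine ⟨fun u : ↥S => unipotentLabel L w hw ϖ (u : ConjClasses ((UnitaryGroup.cmDatum L 3 (Matrix.of fun i j : Fin 3 => if i.val + j.val + 1 = 3 then (1 : L) else 0)).Local v)), hinj, ?_⟩
  exact det_ne_zero_of_label (fun (u : ↥S) (j : Fin 4) => classOrbitalIntegral mU ((gselStar j) L v w hw ϖ) u)
    (fun u : ↥S => unipotentLabel L w hw ϖ (u : ConjClasses ((UnitaryGroup.cmDatum L 3 (Matrix.of fun i j : Fin 3 => if i.val + j.val + 1 = 3 then (1 : L) else 0)).Local v))) hinj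
    (hVan L w hw he h2 ϖ hϖ S hS mU hmU hRao) (hDiag L w hw he h2 ϖ hϖ S hS mU hmU hRao)

/-- EXPORT (iv-a) CLOSED: with T1∕T2∕T3 PAID the tier-0 statement `stub_rankTableWild : RankTableWild gselStar` holds sorry-free (tier 0 pays it BY NAME from the ★
`Theorems/` twin of this export per LEAD ruling (R-15), not by importing this workfile). -/
theorem rankTableWild_gselStar : RankTableWild gselStar :=
  rankTableWild_of stub_U4_label_injOn stub_U4_table_vanishing stub_U4_table_diag_ne_zero

end Summit.HodgeConjecture.HodgeConjecture.Cruxes.H413.F0P3cDyRamFourFrameU4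

end
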